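import Literature.ModelTheory.ExponentialFields.KhovanskiiCurve
import HarnessLib

/-!
# Khovanskii's elimination step III: lifting the zeros, the function `g` and the contact term

Topic `Literature/ModelTheory/ExponentialFields`. The analytic half of one step of Khovanskii's
induction for `L_exp`-terms (A. G. Khovanskii, *Fewnomials* (1991), Ch. III; for Wilkie 1989,
§5): at fixed real parameters `β`, the non-degenerate zeros `x ∈ ℝᴺ` of the square system
`F(β, ·)` lift injectively (`x ↦ (x, e^{s(β,x)}, 1/minorSq)`) to zeros, on the regular curve
`Γ_β ⊆ ℝ^{N+2}` of the lifted stage-1 system (`Khovanskii.curveData`), of the function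
`g = y e^{-s} - 1` (`Khovanskii.gFun`), transversal ones (`realize_contactP_liftPt_ne_zero`), and
`dg(v) = e^{-s} · P` with `P` the contact term (`fderiv_gFun_crossR`). The step inequality
itself is in `KhovanskiiStep.lean`. Everything is **proved**.

## References

* A. G. Khovanskii, *Fewnomials*, Transl. Math. Monogr. 88, AMS (1991), Ch. III. [Khovanskii1991]
* A. J. Wilkie, *On the theory of the real exponential field*, Illinois J. Math. 33 (1989), §5,
  Proposition (p. 402). [Wilkie1989]
-/

noncomputable section

open FirstOrder FirstOrder.Language FirstOrder.Language.Structure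
open Literature.LinearAlgebra.Matrix

namespace Literature.ModelTheory.ExponentialFields

namespace Khovanskii

open ExpTerm RealExpModel

variable {m N : ℕ}

/-! ### The function `g = y e^{-s} - 1`, the contact term and `dg(v) = e^{-s} P` -/

section Contact

variable (G : Fin N → Language.orderedExpRing.Term (Fin m ⊕ Fin (N + 1)))
  (s : Language.orderedExpRing.Term (Fin m ⊕ Fin N)) (β : Fin m → ℝ)

/-- The index of the unknown `y = x_{N+1}` among `x₁, …, x_{N+2}`. [folklore] -/
def yIdx (N : ℕ) : Fin (N + 2) := (Fin.last N).castSucc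

/-- The value of the (twice lifted) term `s` at `(β, z)`. [folklore] -/
def sVal (z : Fin (N + 2) → ℝ) : ℝ := (liftTerm (liftTerm s)).realize (Sum.elim β z)

/-- **The function `g(z) = y · e^{-s} - 1`** whose zeros on `Γ_β` are the lifted zeros of the
original system. [cite: Khovanskii1991, Ch. III] -/
def gFun (z : Fin (N + 2) → ℝ) : ℝ := z (yIdx N) * Real.exp (-sVal s β z) - 1

/-- The realized row of `dy - y ds`. [folklore] -/
def omegaR (z : Fin (N + 2) → ℝ) : Fin (N + 2) → ℝ := fun c => (omegaRow s c).realize (Sum.elim β z)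

/-- Entries of the realized row: `δ_{c,y} - y ∂s/∂x_c`. [folklore] -/
theorem omegaR_apply (z : Fin (N + 2) → ℝ) (c : Fin (N + 2)) :
    omegaR s β z c = (if c = yIdx N then 1 else 0) - z (yIdx N) * grad (liftTerm (liftTerm s)) β z c := by
  rw [omegaR, omegaRow, ExpTerm.realize_add, ExpTerm.realize_neg, ExpTerm.realize_mul, yVar₂, yIdx,
    grad_apply]
  simp only [Term.realize_var, Sum.elim_inr]
  by_cases h : c = (Fin.last N).castSucc
  · subst h
    simp [termPDeriv]
    ring
  · rw [if_neg h, termPDeriv_var_inr_of_ne c _ (Ne.symm h), ExpTerm.realize_zero]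
    ring

/-- **The contact term realizes to the pairing of `dy - y ds` with the tangent field**:
`P(z) = ω(z) ⬝ v(z)`. [folklore] -/
theorem realize_contactP (z : Fin (N + 2) → ℝ) :
    (contactP G s).realize (Sum.elim β z) = omegaR s β z ⬝ᵥ crossR G β z := by
  rw [contactP, ExpTerm.realize_det, crossR, dotProduct_cross]
  congr 1
  ext i j
  simp only [Matrix.map_apply, Matrix.of_apply, snocRow]
  refine Fin.lastCases ?_ (fun r => ?_) i
  · simp [omegaR]
  · simp [jacR_apply, jacH, grad_apply]

/-- `sVal` is smooth with derivative the pairing with the gradient of the lifted `s`. [folklore] -/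
theorem hasFDerivAt_sVal (z : Fin (N + 2) → ℝ) :
    HasFDerivAt (sVal s β) (fderiv ℝ (sVal s β) z) z :=
  ((contDiff_realize (liftTerm (liftTerm s)) β (n := 1)).differentiable one_ne_zero z).hasFDerivAt

/-- **`dg = e^{-s} (dy - y ds)`**: the derivative of `g` paired with any vector. [folklore] -/
theorem fderiv_gFun_apply (z w : Fin (N + 2) → ℝ) :
    fderiv ℝ (gFun s β) z w = Real.exp (-sVal s β z) * (omegaR s β z ⬝ᵥ w) := by
  have h1 : HasFDerivAt (fun z : Fin (N + 2) → ℝ => z (yIdx N))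
      (ContinuousLinearMap.proj (R := ℝ) (φ := fun _ : Fin (N + 2) => ℝ) (yIdx N)) z :=
    hasFDerivAt_apply (yIdx N) z
  have h2 : HasFDerivAt (fun z => Real.exp (-sVal s β z))
      (Real.exp (-sVal s β z) • -(fderiv ℝ (sVal s β) z)) z := (hasFDerivAt_sVal s β z).neg.exp
  have h3 := (h1.mul h2).sub_const 1
  have h4 : HasFDerivAt (gFun s β) _ z := h3
  rw [h4.fderiv]
  have hf : fderiv ℝ (sVal s β) z w = ∑ j, w j * grad (liftTerm (liftTerm s)) β z j :=
    fderiv_realize_apply (liftTerm (liftTerm s)) β z w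
  have hω : omegaR s β z ⬝ᵥ w =
      w (yIdx N) - z (yIdx N) * ∑ j, w j * grad (liftTerm (liftTerm s)) β z j := by
    simp only [dotProduct, omegaR_apply, sub_mul, ite_mul, one_mul, zero_mul,
      Finset.sum_sub_distrib, Finset.sum_ite_eq', Finset.mem_univ, if_true, Finset.mul_sum]
    congr 1
    exact Finset.sum_congr rfl fun j _ => by ring
  rw [hω]
  simp [hf]
  ring

/-- **`dg(v) = e^{-s} · P`** on the tangent field. [cite: Khovanskii1991, Ch. III] -/
theorem fderiv_gFun_crossR (z : Fin (N + 2) → ℝ) :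
    fderiv ℝ (gFun s β) z (crossR G β z) =
      Real.exp (-sVal s β z) * (contactP G s).realize (Sum.elim β z) := by
  rw [fderiv_gFun_apply, realize_contactP]

/-- `g` is differentiable. [folklore] -/
theorem differentiable_gFun : Differentiable ℝ (gFun s β) := by
  intro z
  have h1 : DifferentiableAt ℝ (fun z : Fin (N + 2) → ℝ => z (yIdx N)) z :=
    (hasFDerivAt_apply (yIdx N) z).differentiableAt
  have h2 : DifferentiableAt ℝ (fun z => Real.exp (-sVal s β z)) z :=
    (hasFDerivAt_sVal s β z).neg.exp.differentiableAt
  exact (h1.mul h2).sub_const 1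

end Contact

/-! ### Lifting the non-degenerate zeros of the original system -/

section Lift

variable (F : Fin N → Language.orderedExpRing.Term (Fin m ⊕ Fin N))
  (es : Fin 1 → Language.orderedExpRing.Term (Fin m ⊕ Fin N)) (β : Fin m → ℝ)

/-- The value `e^{s(β, x)}` of the exponential `e = exp(s)` at `x`. [folklore] -/
def eVal (x : Fin N → ℝ) : ℝ := Real.exp ((es 0).realize (Sum.elim β x))

/-- `e = exp(s)` realizes to `e^{s}` in `ℝ`. [folklore] -/
theorem realize_exp_eq_eVal (x : Fin N → ℝ) :
    (func expRingFunc.exp es : Language.orderedExpRing.Term (Fin m ⊕ Fin N)).realize (Sum.elim β x) =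
      eVal es β x := by
  rw [func_exp_eq_termExp, Language.orderedExpRing.realize_exp]
  rfl

/-- The stage-1 point `(x, e^{s(β,x)}) ∈ ℝ^{N+1}`. [folklore] -/
def liftW (x : Fin N → ℝ) : Fin (N + 1) → ℝ := Fin.snoc x (eVal es β x)

/-- **The lift** `x ↦ (x, e^{s(β,x)}, 1 / minorSq) ∈ ℝ^{N+2}` of a point of `ℝᴺ`. [cite: Khovanskii1991, Ch. III] -/
def liftPt (x : Fin N → ℝ) : Fin (N + 2) → ℝ :=
  Fin.snoc (liftW es β x)
    ((minorSq (elimF F (func expRingFunc.exp es))).realize (Sum.elim β (liftW es β x)))⁻¹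

/-- The lift is injective (the first `N` coordinates are `x`). [folklore] -/
theorem liftPt_injective : Function.Injective (liftPt F es β) := by
  intro x x' h
  funext j
  have := congrFun h ((Fin.castSucc j).castSucc)
  simpa [liftPt, liftW] using this

/-- **Stage 1 preserves values**: `G_r(β, x, e^{s(β,x)}) = F_r(β, x)`. [folklore] -/
theorem realize_elimF_liftW (x : Fin N → ℝ) (r : Fin N) :
    (elimF F (func expRingFunc.exp es) r).realize (Sum.elim β (liftW es β x)) =
      (F r).realize (Sum.elim β x) := by
  refine realize_substExp _ _ _ (Sum.elim β x) _ (fun a => ?_) ?_ (F r)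
  · rcases a with c | j <;> simp [iota, liftW]
  · rw [realize_exp_eq_eVal]; simp [yVar, liftW]

/-- The same for all stage-1 points `(x', e^{s(β,x')})`, as a functional identity. [folklore] -/
theorem realize_F_eq (x : Fin N → ℝ) (r : Fin N) :
    (F r).realize (Sum.elim β x) =
      (elimF F (func expRingFunc.exp es) r).realize (Sum.elim β (liftW es β x)) :=
  (realize_elimF_liftW F es β x r).symm

/-- **Chain rule for stage 1**: `∂F_r/∂x_j = ∂G_r/∂x_j + ∂G_r/∂y · e^{s} ∂s/∂x_j` at
`(x, e^{s(β,x)})`. [folklore] -/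
theorem grad_F_eq (x : Fin N → ℝ) (r : Fin N) (j : Fin N) :
    grad (F r) β x j =
      grad (elimF F (func expRingFunc.exp es) r) β (liftW es β x) (Fin.castSucc j) +
        eVal es β x * grad (es 0) β x j *
          grad (elimF F (func expRingFunc.exp es) r) β (liftW es β x) (Fin.last N) := by
  classical
  set Gr := elimF F (func expRingFunc.exp es) r with hGr
  -- the path `u ↦ (update x j u, e^{s(update x j u)})`
  set Ψ : ℝ → Fin (N + 1) → ℝ := fun u => liftW es β (Function.update x j u) with hΨ
  have hE : HasDerivAt (fun u => eVal es β (Function.update x j u))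
      (eVal es β x * grad (es 0) β x j) (x j) := by
    have h := (hasDerivAt_realize_termPDeriv β x j (es 0)).exp
    simp only [Function.update_eq_self] at h
    rw [grad_apply]
    exact h
  have hΨ' : HasDerivAt Ψ (Fin.snoc (Pi.single j 1) (eVal es β x * grad (es 0) β x j)) (x j) := by
    rw [hasDerivAt_pi]
    intro c
    refine Fin.lastCases ?_ (fun i => ?_) c
    · simp only [hΨ, liftW, Fin.snoc_last]
      exact hE
    · simp only [hΨ, liftW, Fin.snoc_castSucc]
      by_cases hij : i = j
      · subst hij
        simpa using hasDerivAt_id (x i) |>.congr_of_eventuallyEq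
          (Filter.Eventually.of_forall fun u => by simp)
      · have : (fun u => Function.update x j u i) = fun _ => x i := by
          funext u; rw [Function.update_of_ne hij]
        rw [this, Pi.single_eq_of_ne hij]
        exact hasDerivAt_const _ _
  -- `F_r ∘ (update x j)` is `G_r ∘ Ψ`
  have hcomp : (fun u => (F r).realize (Sum.elim β (Function.update x j u))) =
      fun u => Gr.realize (Sum.elim β (Ψ u)) := by
    funext u
    exact realize_F_eq F es β _ r
  have hG : HasFDerivAt (fun w : Fin (N + 1) → ℝ => Gr.realize (Sum.elim β w))
      (fderiv ℝ (fun w : Fin (N + 1) → ℝ => Gr.realize (Sum.elim β w)) (Ψ (x j))) (Ψ (x j)) :=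
    ((contDiff_realize Gr β (n := 1)).differentiable one_ne_zero _).hasFDerivAt
  have hchain := hG.comp_hasDerivAt (x j) hΨ'
  have hF := hasDerivAt_realize_termPDeriv β x j (F r)
  rw [hcomp] at hF
  have heq := hF.unique hchain
  have hΨx : Ψ (x j) = liftW es β x := by simp [hΨ]
  rw [hΨx, fderiv_realize_apply, Fin.sum_univ_castSucc] at heq
  rw [grad_apply, heq]
  simp only [Fin.snoc_castSucc, Fin.snoc_last]
  rw [Finset.sum_eq_single j]
  · simp
  · intro i _ hij
    rw [Pi.single_eq_of_ne hij, zero_mul]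
  · simp

/-- **Non-degeneracy passes to stage 1**: if `det ∂F/∂x (β, x) ≠ 0` then the gradient rows of
the stage-1 system at `(x, e^{s(β,x)})` are independent. [folklore] -/
theorem linearIndependent_grad_elimF {x : Fin N → ℝ}
    (hx : (Matrix.of fun r => grad (F r) β x).det ≠ 0) :
    LinearIndependent ℝ (fun r => grad (elimF F (func expRingFunc.exp es) r) β (liftW es β x)) := by
  have hF : LinearIndependent ℝ (fun r => grad (F r) β x) :=
    (linearIndependent_rows_iff_det_ne_zero _).2 hx
  rw [Fintype.linearIndependent_iff] at hF ⊢
  intro g hg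
  apply hF g
  funext j
  have hcs := congrFun hg (Fin.castSucc j)
  have hl := congrFun hg (Fin.last N)
  simp only [Finset.sum_apply, Pi.smul_apply, smul_eq_mul, Pi.zero_apply] at hcs hl ⊢
  simp_rw [grad_F_eq F es β x _ j, mul_add]
  rw [Finset.sum_add_distrib, hcs, zero_add]
  have : ∀ r : Fin N, g r * (eVal es β x * grad (es 0) β x j *
      grad (elimF F (func expRingFunc.exp es) r) β (liftW es β x) (Fin.last N)) =
        (eVal es β x * grad (es 0) β x j) *
          (g r * grad (elimF F (func expRingFunc.exp es) r) β (liftW es β x) (Fin.last N)) :=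
    fun r => by ring
  simp_rw [this]
  rw [← Finset.mul_sum, hl, mul_zero]

/-- Hence `minorSq ≠ 0` at the stage-1 point of a non-degenerate zero. [folklore] -/
theorem realize_minorSq_liftW_ne_zero {x : Fin N → ℝ}
    (hx : (Matrix.of fun r => grad (F r) β x).det ≠ 0) :
    (minorSq (elimF F (func expRingFunc.exp es))).realize (Sum.elim β (liftW es β x)) ≠ 0 := by
  rw [realize_minorSq]
  have hne : cross (jacW (elimF F (func expRingFunc.exp es)) β (liftW es β x)) ≠ 0 :=
    cross_ne_zero_of_linearIndependent_rows _ (linearIndependent_grad_elimF F es β hx)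
  obtain ⟨c, hc⟩ := Function.ne_iff.1 hne
  intro hsum
  have h0 := (Finset.sum_eq_zero_iff_of_nonneg fun c _ => sq_nonneg _).1 hsum c (Finset.mem_univ c)
  exact hc (pow_eq_zero_iff two_ne_zero |>.1 h0)

/-- **The lift of a non-degenerate zero lies on `Γ_β`.** [folklore] -/
theorem sysFun_liftPt {x : Fin N → ℝ} (hx : x ∈ ndZeros F β) :
    sysFun (liftH (elimF F (func expRingFunc.exp es))) β (liftPt F es β x) = 0 := by
  funext r
  rw [Pi.zero_apply, sysFun, liftH, liftPt]
  refine Fin.lastCases ?_ (fun r => ?_) r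
  · rw [realize_liftSys_last', inv_mul_cancel₀ (realize_minorSq_liftW_ne_zero F es β hx.2)]
    ring
  · rw [realize_liftSys_castSucc', realize_elimF_liftW]
    exact hx.1 r

/-- `sVal` at the lift is `s(β, x)`. [folklore] -/
theorem sVal_liftPt (x : Fin N → ℝ) :
    sVal (es 0) β (liftPt F es β x) = (es 0).realize (Sum.elim β x) := by
  rw [sVal, liftPt, realize_liftTerm', liftW, realize_liftTerm']

/-- **The lift of a zero is a zero of `g`**: `e^{s} · e^{-s} - 1 = 0`. [folklore] -/
theorem gFun_liftPt (x : Fin N → ℝ) : gFun (es 0) β (liftPt F es β x) = 0 := by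
  rw [gFun, sVal_liftPt]
  have hy : liftPt F es β x (yIdx N) = eVal es β x := by
    simp [liftPt, liftW, yIdx]
  rw [hy, eVal, ← Real.exp_add, add_neg_cancel, Real.exp_zero, sub_self]

/-- The realized `dy - y ds` row at a lifted point: `(-e^{s} ∇s, 1, 0)`. [folklore] -/
theorem omegaR_liftPt (x : Fin N → ℝ) :
    omegaR (es 0) β (liftPt F es β x) =
      Fin.snoc (Fin.snoc (-(eVal es β x) • grad (es 0) β x) 1) 0 := by
  have hy : liftPt F es β x (yIdx N) = eVal es β x := by simp [liftPt, liftW, yIdx]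
  have hgrad : grad (liftTerm (liftTerm (es 0))) β (liftPt F es β x) =
      Fin.snoc (Fin.snoc (grad (es 0) β x) 0) 0 := by
    rw [liftPt, grad_liftTerm', liftW, grad_liftTerm']
  funext c
  rw [omegaR_apply, hy, hgrad]
  refine Fin.lastCases ?_ (fun c' => ?_) c
  · have : (Fin.last (N + 1) : Fin (N + 2)) ≠ (Fin.last N).castSucc := (Fin.castSucc_lt_last _).ne'
    simp [yIdx, this]
  · refine Fin.lastCases ?_ (fun j => ?_) c'
    · simp [yIdx]
    · have : (Fin.castSucc (Fin.castSucc j) : Fin (N + 2)) ≠ yIdx N := by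
        rw [yIdx]
        exact fun h => (Fin.castSucc_lt_last j).ne (Fin.castSucc_injective _ h)
      simp [this]

/-- **Transversality at the lifts**: the rows `∇(liftH)ᵣ` and `ω = dy - y ds` are linearly
independent at the lift of a non-degenerate zero, i.e. `P ≠ 0` there. [cite: Khovanskii1991, Ch. III] -/
theorem linearIndependent_snoc_jacR_omegaR_liftPt {x : Fin N → ℝ} (hx : x ∈ ndZeros F β) :
    LinearIndependent ℝ (Fin.snoc (fun r => jacR (elimF F (func expRingFunc.exp es)) β (liftPt F es β x) r)
      (omegaR (es 0) β (liftPt F es β x)) :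
        Fin (N + 2) → Fin (N + 2) → ℝ) := by
  classical
  set G := elimF F (func expRingFunc.exp es) with hG
  set w := liftW es β x with hw
  set S := (minorSq G).realize (Sum.elim β w) with hS
  have hSne : S ≠ 0 := realize_minorSq_liftW_ne_zero F es β hx.2
  have hF : LinearIndependent ℝ (fun r => grad (F r) β x) :=
    (linearIndependent_rows_iff_det_ne_zero _).2 hx.2
  -- explicit rows
  have hrow_cs : ∀ r : Fin N, jacR G β (liftPt F es β x) (Fin.castSucc r) =
      Fin.snoc (grad (G r) β w) 0 := fun r => by
    rw [jacR_apply, liftH, liftPt, grad_liftSys_castSucc']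
  have hrow_last : jacR G β (liftPt F es β x) (Fin.last N) =
      Fin.snoc (S⁻¹ • grad (minorSq G) β w) S := by
    rw [jacR_apply, liftH, liftPt, grad_liftSys_last']
  have hω := omegaR_liftPt F es β x
  rw [Fintype.linearIndependent_iff]
  intro g hg
  -- coordinates of the vanishing combination
  have hcoord := fun c => congrFun hg c
  simp only [Finset.sum_apply, Pi.smul_apply, smul_eq_mul, Pi.zero_apply, Fin.sum_univ_castSucc,
    Fin.snoc_castSucc, Fin.snoc_last] at hcoord
  -- the `t`-coordinate gives `g (castSucc last) = 0`
  have hb : g (Fin.castSucc (Fin.last N)) = 0 := by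
    have h := hcoord (Fin.last (N + 1))
    simp only [hrow_cs, hrow_last, hω, Fin.snoc_last, mul_zero, Finset.sum_const_zero, zero_add,
      add_zero] at h
    exact (mul_eq_zero.1 h).resolve_right hSne
  -- the `y`-coordinate: `Σ g_r ∂_y G_r + c = 0`
  have hy : ∑ r : Fin N, g (Fin.castSucc (Fin.castSucc r)) * grad (G r) β w (Fin.last N) +
      g (Fin.last (N + 1)) = 0 := by
    have h := hcoord (Fin.castSucc (Fin.last N))
    simp only [hrow_cs, hrow_last, hω, Fin.snoc_castSucc, Fin.snoc_last, hb, zero_mul, add_zero,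
      mul_one] at h
    exact h
  -- the `x_j`-coordinates: `Σ g_r ∂_{x_j} G_r - c e^{s} ∂_j s = 0`
  have hxj : ∀ j : Fin N, ∑ r : Fin N, g (Fin.castSucc (Fin.castSucc r)) * grad (G r) β w (Fin.castSucc j)
      + g (Fin.last (N + 1)) * (-(eVal es β x) * grad (es 0) β x j) = 0 := by
    intro j
    have h := hcoord (Fin.castSucc (Fin.castSucc j))
    simp only [hrow_cs, hrow_last, hω, Fin.snoc_castSucc, hb, zero_mul, add_zero, Pi.smul_apply,
      smul_eq_mul, neg_mul] at h ⊢
    exact h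
  -- hence `Σ g_r ∇F_r = 0`, so the `g_r` vanish
  have ha : ∀ r : Fin N, g (Fin.castSucc (Fin.castSucc r)) = 0 := by
    have hsum : ∑ r : Fin N, g (Fin.castSucc (Fin.castSucc r)) • grad (F r) β x = 0 := by
      funext j
      simp only [Finset.sum_apply, Pi.smul_apply, smul_eq_mul, Pi.zero_apply]
      simp_rw [grad_F_eq F es β x _ j, mul_add]
      rw [Finset.sum_add_distrib]
      have e1 : ∀ r : Fin N, g (Fin.castSucc (Fin.castSucc r)) * (eVal es β x * grad (es 0) β x j *
          grad (G r) β w (Fin.last N)) = (eVal es β x * grad (es 0) β x j) *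
            (g (Fin.castSucc (Fin.castSucc r)) * grad (G r) β w (Fin.last N)) := fun r => by ring
      simp_rw [← hw, ← hG, e1]
      rw [← Finset.mul_sum]
      have e2 : ∑ r : Fin N, g (Fin.castSucc (Fin.castSucc r)) * grad (G r) β w (Fin.last N) =
          -g (Fin.last (N + 1)) := by linarith [hy]
      rw [e2]
      linarith [hxj j]
    have := (Fintype.linearIndependent_iff.1 hF) (fun r => g (Fin.castSucc (Fin.castSucc r))) hsum
    exact this
  have hc : g (Fin.last (N + 1)) = 0 := by
    have h := hy
    simp only [ha, zero_mul, Finset.sum_const_zero, zero_add] at h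
    exact h
  intro i
  refine Fin.lastCases hc (fun i => ?_) i
  refine Fin.lastCases hb (fun r => ?_) i
  exact ha r

/-- **`P ≠ 0` at the lift of a non-degenerate zero.** [cite: Khovanskii1991, Ch. III] -/
theorem realize_contactP_liftPt_ne_zero {x : Fin N → ℝ} (hx : x ∈ ndZeros F β) :
    (contactP (elimF F (func expRingFunc.exp es)) (es 0)).realize (Sum.elim β (liftPt F es β x)) ≠ 0 := by
  rw [realize_contactP, crossR, dotProduct_cross]
  have hli := linearIndependent_snoc_jacR_omegaR_liftPt F es β hx
  have e : (fun i => snocRow (jacR (elimF F (func expRingFunc.exp es)) β (liftPt F es β x))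
      (omegaR (es 0) β (liftPt F es β x)) i) =
        (Fin.snoc (fun r => jacR (elimF F (func expRingFunc.exp es)) β (liftPt F es β x) r)
          (omegaR (es 0) β (liftPt F es β x)) : Fin (N + 2) → Fin (N + 2) → ℝ) := by
    funext i
    refine Fin.lastCases ?_ (fun r => ?_) i
    · rw [snocRow_last, Fin.snoc_last]
    · rw [snocRow_castSucc, Fin.snoc_castSucc]
  rw [← linearIndependent_rows_iff_det_ne_zero, e]
  exact hli

end Lift

end Khovanskii

end Literature.ModelTheory.ExponentialFields
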